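import Mathlib
import HarnessLib

/-!
# Ward ⇒ Möbius, part 2: weak translation invariance of a continuous function integrates

Support file for item stmt-CriticalPhenomena-5357 (`WardToMoebius`, route `PrimaryAtInfinity`,
sub-problem `Ising3DConformalLimit`).

Let `U` be an open subset of a finite-dimensional real normed space `W` (Lebesgue/Haar measure
`μ`), `F : W → ℝ` continuous on `U`, and `c ∈ W` a direction such that the WEAK translation
identity `∫ F · ∂_c φ dμ = 0` holds for every smooth `φ` compactly supported in `U`. Then `F` is
invariant under the translation by `c` along every segment `[x, x + c] ⊆ U`:
`F (x + c) = F x` (`apply_add_eq_of_weak_translation_invariant`). Proof: for test functions `φ`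
supported in a small tube neighbourhood of `x`, `s ↦ ∫ F(z) φ(z − s c) dz` has derivative
`−∫ F ∂_c(φ(· − s c)) = 0` (differentiation under the integral sign,
`hasDerivAt_integral_of_dominated_loc_of_deriv_le`), hence `∫ (F(z + c) − F(z)) φ(z) dz = 0`, and a
continuous function that is weakly zero on an open set vanishes there
(`IsOpen.ae_eq_zero_of_integral_contDiff_smul_eq_zero`, `Measure.eqOn_open_of_ae_eq`).
A corollary propagates the invariance along preconnected open sets of admissible translation
vectors (`IsPreconnected.induction₂'`).

This is the integration step ("weak first-order identities with smooth coefficients integrate along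
the flows, and continuity upgrades a.e. to everywhere") of the `WardToMoebius` item, for the
translation flow. References: folklore distribution theory (e.g. Hörmander, *The Analysis of Linear
Partial Differential Operators I*, Thm 3.1.4'). No definitions are introduced.
-/

noncomputable section

open MeasureTheory Set Function Filter Metric
open scoped Topology

namespace Summit.CriticalPhenomena.Ising3DConformalLimit.WardToMoebius

section Topological

variable {W : Type*} [NormedAddCommGroup W]

/-- A function continuous on an open set `U`, multiplied by a continuous function whose topological
support lies in `U`, is continuous everywhere. [folklore] -/
theorem continuous_mul_of_tsupport_subset {U : Set W} (hU : IsOpen U) {F ψ : W → ℝ}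
    (hF : ContinuousOn F U) (hψ : Continuous ψ) (hsupp : tsupport ψ ⊆ U) :
    Continuous fun z => F z * ψ z := by
  refine continuous_iff_continuousAt.2 fun z => ?_
  by_cases hz : z ∈ U
  · exact (hF.continuousAt (hU.mem_nhds hz)).mul hψ.continuousAt
  · have hz' : z ∉ tsupport ψ := fun h => hz (hsupp h)
    have hev : (fun w => F w * ψ w) =ᶠ[𝓝 z] fun _ => 0 := by
      filter_upwards [notMem_tsupport_iff_eventuallyEq.1 hz'] with w hw
      simp [hw]
    exact (continuousAt_const.congr hev.symm)

/-- The topological support of a translate: `tsupport (φ(· − v)) = (· − v) ⁻¹' tsupport φ`.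
[folklore] -/
theorem tsupport_comp_sub (φ : W → ℝ) (v : W) :
    tsupport (fun z => φ (z - v)) = (fun z => z - v) ⁻¹' tsupport φ := by
  have h : (fun z => φ (z - v)) = φ ∘ (Homeomorph.addRight (-v)) := by
    funext z; simp [sub_eq_add_neg]
  rw [h, tsupport, tsupport, Function.support_comp_eq_preimage, ← Homeomorph.preimage_closure]
  congr 1
  funext z
  simp [sub_eq_add_neg]

/-- A translate of a compactly supported function is compactly supported. [folklore] -/
theorem hasCompactSupport_comp_sub {φ : W → ℝ} (hφ : HasCompactSupport φ) (v : W) :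
    HasCompactSupport fun z => φ (z - v) := by
  have h : (fun z => φ (z - v)) = φ ∘ (Homeomorph.addRight (-v)) := by
    funext z; simp [sub_eq_add_neg]
  rw [h]
  exact hφ.comp_homeomorph _

end Topological

section General

variable {W : Type*} [NormedAddCommGroup W] [NormedSpace ℝ W]

/-- A translate of a smooth function is smooth. [folklore] -/
theorem contDiff_comp_sub {φ : W → ℝ} {m : WithTop ℕ∞} (hφ : ContDiff ℝ m φ) (v : W) :
    ContDiff ℝ m fun z => φ (z - v) :=
  hφ.comp (contDiff_id.sub contDiff_const)

/-- The derivative of a translate is the translate of the derivative. [folklore] -/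
theorem fderiv_comp_sub (φ : W → ℝ) (v z : W) :
    fderiv ℝ (fun w => φ (w - v)) z = fderiv ℝ φ (z - v) := by
  have h := fderiv_comp_add_right (𝕜 := ℝ) (f := φ) (x := z) (-v)
  simpa [sub_eq_add_neg] using h

end General

section Measure

variable {W : Type*} [NormedAddCommGroup W] [NormedSpace ℝ W] [FiniteDimensional ℝ W]
  [MeasurableSpace W] [BorelSpace W] (μ : Measure W) [μ.IsAddHaarMeasure]

/-- **Weak translation invariance integrates along segments.** Let `U ⊆ W` be open, `F`
continuous on `U`, and suppose the weak identity `∫ F · ∂_c φ dμ = 0` holds for every smooth `φ`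
compactly supported in `U` (the distributional derivative `∂_c F` vanishes on `U`). If the
segment `[x, x + c]` lies in `U`, then `F (x + c) = F x`. (Hörmander, ALPDO I, Thm 3.1.4' is the
distributional statement; here integrated against the translation flow.) [folklore] -/
theorem apply_add_eq_of_weak_translation_invariant
    {U : Set W} (hU : IsOpen U) {F : W → ℝ} (hF : ContinuousOn F U) {c : W}
    (hweak : ∀ φ : W → ℝ, ContDiff ℝ (⊤ : ℕ∞) φ → HasCompactSupport φ → tsupport φ ⊆ U →
      ∫ z, F z * fderiv ℝ φ z c ∂μ = 0)
    {x : W} (hseg : ∀ s ∈ Icc (0 : ℝ) 1, x + s • c ∈ U) : F (x + c) = F x := by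
  /- Step 1: a margin `δ` around the segment. -/
  obtain ⟨δ, hδ, hmargin⟩ :
      ∃ δ : ℝ, 0 < δ ∧ ∀ s : ℝ, s ∈ Icc (-δ) (1 + δ) → x + s • c ∈ U := by
    have h0 : x ∈ U := by simpa using hseg 0 ⟨le_rfl, zero_le_one⟩
    have h1 : x + c ∈ U := by simpa using hseg 1 ⟨zero_le_one, le_rfl⟩
    obtain ⟨ε₀, hε₀, hb₀⟩ := Metric.isOpen_iff.1 hU x h0
    obtain ⟨ε₁, hε₁, hb₁⟩ := Metric.isOpen_iff.1 hU (x + c) h1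
    have hmin : 0 < min ε₀ ε₁ := lt_min hε₀ hε₁
    refine ⟨min ε₀ ε₁ / (‖c‖ + 1), by positivity, fun s hs => ?_⟩
    have hkey : min ε₀ ε₁ / (‖c‖ + 1) * ‖c‖ < min ε₀ ε₁ := by
      rw [div_mul_eq_mul_div, div_lt_iff₀ (by positivity)]
      nlinarith [norm_nonneg c]
    rcases lt_or_ge s 0 with hs0 | hs0
    · apply hb₀
      rw [mem_ball, dist_eq_norm, add_sub_cancel_left, norm_smul, Real.norm_eq_abs,
        abs_of_neg hs0]
      have : -s ≤ min ε₀ ε₁ / (‖c‖ + 1) := by linarith [hs.1]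
      calc -s * ‖c‖ ≤ min ε₀ ε₁ / (‖c‖ + 1) * ‖c‖ := by gcongr
        _ < ε₀ := hkey.trans_le (min_le_left _ _)
    rcases le_or_gt s 1 with hs1 | hs1
    · exact hseg s ⟨hs0, hs1⟩
    · apply hb₁
      rw [mem_ball, dist_eq_norm, show x + s • c - (x + c) = (s - 1) • c by module, norm_smul,
        Real.norm_eq_abs, abs_of_pos (by linarith)]
      have : s - 1 ≤ min ε₀ ε₁ / (‖c‖ + 1) := by linarith [hs.2]
      calc (s - 1) * ‖c‖ ≤ min ε₀ ε₁ / (‖c‖ + 1) * ‖c‖ := by gcongr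
        _ < ε₁ := hkey.trans_le (min_le_right _ _)
  /- Step 2: a tube neighbourhood `U'` of `x` whose `R`-translates stay in `U`. -/
  set R : Set ℝ := Icc (-δ) (1 + δ) with hR
  have hRc : IsCompact R := isCompact_Icc
  have hballR : ∀ s₀ ∈ Icc (0 : ℝ) 1, ball s₀ δ ⊆ R := by
    intro s₀ hs₀ s hs
    rw [mem_ball, Real.dist_eq] at hs
    have := abs_lt.1 hs
    exact ⟨by linarith [hs₀.1], by linarith [hs₀.2]⟩
  set U' : Set W := interior {z | ∀ s ∈ R, z + s • c ∈ U} with hU'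
  have hU'o : IsOpen U' := isOpen_interior
  have hxU' : x ∈ U' := by
    rw [hU', mem_interior_iff_mem_nhds]
    apply hRc.eventually_forall_of_forall_eventually
    intro s hs
    have hcont : Continuous fun p : W × ℝ => p.1 + p.2 • c := by fun_prop
    exact hcont.continuousAt.preimage_mem_nhds (hU.mem_nhds (hmargin s hs))
  have hU'sub : ∀ z ∈ U', ∀ s ∈ R, z + s • c ∈ U := fun z hz => interior_subset hz
  have h0R : (0 : ℝ) ∈ R := ⟨by linarith, by linarith⟩
  have h1R : (1 : ℝ) ∈ R := ⟨by linarith, by linarith⟩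
  have hU'U : U' ⊆ U := fun z hz => by simpa using hU'sub z hz 0 h0R
  /- Step 3: for `φ` supported in `U'`, `s ↦ ∫ F(z) φ(z - s • c)` is constant on `[0,1]`. -/
  have hconst : ∀ φ : W → ℝ, ContDiff ℝ (⊤ : ℕ∞) φ → HasCompactSupport φ → tsupport φ ⊆ U' →
      ∫ z, F z * φ (z - (1 : ℝ) • c) ∂μ = ∫ z, F z * φ (z - (0 : ℝ) • c) ∂μ := by
    intro φ hφ hφc hφU'
    -- translates by `s ∈ R` are supported in `U`
    have hsuppR : ∀ s ∈ R, tsupport (fun z => φ (z - s • c)) ⊆ U := by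
      intro s hs z hz
      rw [tsupport_comp_sub] at hz
      have := hU'sub _ (hφU' hz) s hs
      simpa using this
    -- the compact set swept by the support, and bounds
    set K' : Set W := (fun p : W × ℝ => p.1 + p.2 • c) '' (tsupport φ ×ˢ R) with hK'
    have hK'c : IsCompact K' := (hφc.prod hRc).image (by fun_prop)
    have hK'U : K' ⊆ U := by
      rintro _ ⟨⟨y, s⟩, ⟨hy, hs⟩, rfl⟩
      exact hU'sub y (hφU' hy) s hs
    obtain ⟨M₀, hM₀⟩ := hK'c.exists_bound_of_continuousOn (hF.mono hK'U)
    obtain ⟨C₀, hC₀⟩ := (hφ.continuous_fderiv (by simp)).bounded_above_of_compact_support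
      (hφc.fderiv (𝕜 := ℝ))
    set M : ℝ := max M₀ 0 with hMdef
    set C : ℝ := max C₀ 0 with hCdef
    have hM : ∀ z ∈ K', ‖F z‖ ≤ M := fun z hz => (hM₀ z hz).trans (le_max_left _ _)
    have hC : ∀ y, ‖fderiv ℝ φ y‖ ≤ C := fun y => (hC₀ y).trans (le_max_left _ _)
    have hM0 : 0 ≤ M := le_max_right _ _
    have hC0 : 0 ≤ C := le_max_right _ _
    -- the family and its `s`-derivative
    set G : ℝ → W → ℝ := fun s z => F z * φ (z - s • c) with hG
    set G' : ℝ → W → ℝ := fun s z => F z * (fderiv ℝ φ (z - s • c)) (-c) with hG'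
    have hGcont : ∀ s ∈ R, Continuous (G s) := fun s hs =>
      continuous_mul_of_tsupport_subset hU hF (hφ.continuous.comp (by fun_prop)) (hsuppR s hs)
    have hG'cont : ∀ s ∈ R, Continuous (G' s) := by
      intro s hs
      refine continuous_mul_of_tsupport_subset hU hF ?_ ?_
      · exact ((hφ.continuous_fderiv (by simp)).comp (by fun_prop)).clm_apply continuous_const
      · refine Subset.trans ?_ (hsuppR s hs)
        refine closure_minimal ?_ (isClosed_tsupport _)
        intro z hz
        rw [tsupport_comp_sub]
        by_contra hz'
        apply hz
        simp [fderiv_of_notMem_tsupport (𝕜 := ℝ) hz']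
    have hdiff : ∀ z s, HasDerivAt (fun s => G s z) (G' s z) s := by
      intro z s
      have h1 : HasDerivAt (fun s : ℝ => z - s • c) (-c) s := by
        simpa using ((hasDerivAt_id s).smul_const c).const_sub z
      have h2 : HasDerivAt (fun s : ℝ => φ (z - s • c)) (fderiv ℝ φ (z - s • c) (-c)) s :=
        (hφ.differentiable (by simp) _).hasFDerivAt.comp_hasDerivAt s h1
      exact h2.const_mul (F z)
    -- bound on the derivative, supported in `K'`
    have hbound : ∀ z, ∀ s ∈ R, ‖G' s z‖ ≤ K'.indicator (fun _ => M * (C * ‖c‖)) z := by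
      intro z s hs
      by_cases hzs : z - s • c ∈ tsupport φ
      · have hzK' : z ∈ K' := ⟨(z - s • c, s), ⟨hzs, hs⟩, by simp⟩
        rw [indicator_of_mem hzK', hG', norm_mul]
        refine mul_le_mul (hM z hzK') ?_ (norm_nonneg _) hM0
        exact (ContinuousLinearMap.le_opNorm _ _).trans
          (by rw [norm_neg]; exact mul_le_mul_of_nonneg_right (hC _) (norm_nonneg _))
      · have : G' s z = 0 := by simp [hG', fderiv_of_notMem_tsupport (𝕜 := ℝ) hzs]
        rw [this, norm_zero]
        exact indicator_nonneg (fun _ _ => by positivity) z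
    have hbound_int : Integrable (K'.indicator fun _ => M * (C * ‖c‖)) μ :=
      (integrable_indicator_iff hK'c.measurableSet).2
        (integrableOn_const (hK'c.measure_lt_top (μ := μ)).ne)
    -- derivative of the pairing vanishes on `[0,1]`
    set g : ℝ → ℝ := fun s => ∫ z, G s z ∂μ with hg
    have hderiv : ∀ s₀ ∈ Icc (0 : ℝ) 1, HasDerivAt g 0 s₀ := by
      intro s₀ hs₀
      have hs₀R : s₀ ∈ R := hballR s₀ hs₀ (mem_ball_self hδ)
      have key := hasDerivAt_integral_of_dominated_loc_of_deriv_le (μ := μ) (F := G) (F' := G')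
        (x₀ := s₀) (bound := K'.indicator fun _ => M * (C * ‖c‖)) (ball_mem_nhds s₀ hδ)
        (Filter.eventually_of_mem (ball_mem_nhds s₀ hδ)
          fun s hs => (hGcont s (hballR s₀ hs₀ hs)).aestronglyMeasurable)
        ((hGcont s₀ hs₀R).integrable_of_hasCompactSupport
          ((hasCompactSupport_comp_sub hφc (s₀ • c)).mul_left))
        (hG'cont s₀ hs₀R).aestronglyMeasurable
        (Filter.Eventually.of_forall fun z s hs => hbound z s (hballR s₀ hs₀ hs))
        hbound_int
        (Filter.Eventually.of_forall fun z s _ => hdiff z s)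
      have hzero : ∫ z, G' s₀ z ∂μ = 0 := by
        have h1 : ∀ z, G' s₀ z = -(F z * fderiv ℝ (fun w => φ (w - s₀ • c)) z c) := by
          intro z
          simp only [hG', fderiv_comp_sub, map_neg, mul_neg]
        simp_rw [h1, integral_neg]
        rw [hweak _ (contDiff_comp_sub hφ _) (hasCompactSupport_comp_sub hφc _) (hsuppR s₀ hs₀R),
          neg_zero]
      simpa [hzero] using key.2
    have := constant_of_has_deriv_right_zero (f := g) (a := 0) (b := 1)
      (fun s hs => (hderiv s hs).continuousAt.continuousWithinAt)
      (fun s hs => (hderiv s (Ico_subset_Icc_self hs)).hasDerivWithinAt) 1 ⟨zero_le_one, le_rfl⟩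
    simpa [hg, hG] using this
  /- Step 4: `z ↦ F (z + c) - F z` is weakly zero on `U'`, hence zero there. -/
  have hcontU' : ContinuousOn (fun z => F (z + c) - F z) U' := by
    refine ContinuousOn.sub ?_ (hF.mono hU'U)
    refine hF.comp (by fun_prop) fun z hz => ?_
    simpa using hU'sub z hz 1 h1R
  have hae : ∀ᵐ z ∂μ, z ∈ U' → F (z + c) - F z = 0 := by
    apply hU'o.ae_eq_zero_of_integral_contDiff_smul_eq_zero
      (hcontU'.locallyIntegrableOn hU'o.measurableSet)
    intro φ hφ hφc hφU'
    have h1 := hconst φ hφ hφc hφU'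
    simp only [one_smul, zero_smul, sub_zero] at h1
    rw [← integral_add_right_eq_self (μ := μ) (fun z => F z * φ (z - c)) c] at h1
    simp only [add_sub_cancel_right] at h1
    have hi1 : Integrable (fun z => F (z + c) * φ z) μ := by
      refine Continuous.integrable_of_hasCompactSupport ?_ hφc.mul_left
      exact continuous_mul_of_tsupport_subset hU'o
        (hF.comp (by fun_prop) fun z hz => by simpa using hU'sub z hz 1 h1R) hφ.continuous hφU'
    have hi2 : Integrable (fun z => F z * φ z) μ :=
      (continuous_mul_of_tsupport_subset hU'o (hF.mono hU'U) hφ.continuous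
        hφU').integrable_of_hasCompactSupport hφc.mul_left
    calc ∫ z, φ z • (F (z + c) - F z) ∂μ
        = ∫ z, (F (z + c) * φ z - F z * φ z) ∂μ := by
          congr 1; funext z; simp only [smul_eq_mul]; ring
      _ = 0 := by rw [integral_sub hi1 hi2, h1, sub_self]
  have heq : EqOn (fun z => F (z + c) - F z) (fun _ => 0) U' :=
    Measure.eqOn_open_of_ae_eq ((ae_restrict_iff' hU'o.measurableSet).2 hae) hU'o hcontU'
      continuousOn_const
  have := heq hxU'
  simp only at this
  linarith

/-- **Propagation along a preconnected set of translation vectors.** In the setting of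
`apply_add_eq_of_weak_translation_invariant`, let the admissible directions be `L v`, `v ∈ V`, for a
continuous linear map `L : V → W`, and suppose the weak identity holds for every direction `L v`.
If `O ⊆ V` is open and preconnected and `x + L v ∈ U` for all `v ∈ O`, then `v ↦ F (x + L v)` is
constant on `O` (locally constant by the segment version, then `IsPreconnected.induction₂'`).
[folklore] -/
theorem apply_add_eq_of_weak_translation_invariant_of_isPreconnected
    {V : Type*} [NormedAddCommGroup V] [NormedSpace ℝ V] (L : V →L[ℝ] W)
    {U : Set W} (hU : IsOpen U) {F : W → ℝ} (hF : ContinuousOn F U)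
    (hweak : ∀ (v : V) (φ : W → ℝ), ContDiff ℝ (⊤ : ℕ∞) φ → HasCompactSupport φ →
      tsupport φ ⊆ U → ∫ z, F z * fderiv ℝ φ z (L v) ∂μ = 0)
    {x : W} {O : Set V} (hO : IsOpen O) (hOc : IsPreconnected O) (hOU : ∀ v ∈ O, x + L v ∈ U)
    {v w : V} (hv : v ∈ O) (hw : w ∈ O) : F (x + L v) = F (x + L w) := by
  have hloc : ∀ v ∈ O, ∀ ε, ball v ε ⊆ O → ∀ w ∈ ball v ε, F (x + L w) = F (x + L v) := by
    intro v hv ε hball w hw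
    have hseg : ∀ s ∈ Icc (0 : ℝ) 1, x + L v + s • L (w - v) ∈ U := by
      intro s hs
      have hmem : v + s • (w - v) ∈ ball v ε := by
        rw [mem_ball, dist_eq_norm, add_sub_cancel_left, norm_smul, Real.norm_eq_abs,
          abs_of_nonneg hs.1]
        rw [mem_ball, dist_eq_norm] at hw
        calc s * ‖w - v‖ ≤ 1 * ‖w - v‖ := by gcongr; exact hs.2
          _ < ε := by simpa using hw
      have := hOU _ (hball hmem)
      simpa [map_add, map_smul, add_assoc] using this
    have key := apply_add_eq_of_weak_translation_invariant μ hU hF (c := L (w - v))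
      (fun φ hφ hφc hφU => hweak (w - v) φ hφ hφc hφU) hseg
    have hx : x + L v + L (w - v) = x + L w := by simp [map_sub]
    rwa [hx] at key
  refine hOc.induction₂' (fun v w => F (x + L v) = F (x + L w)) (fun v hv => ?_)
    (fun _ _ _ _ _ _ h₁ h₂ => h₁.trans h₂) hv hw
  obtain ⟨ε, hε, hball⟩ := Metric.isOpen_iff.1 hO v hv
  filter_upwards [mem_nhdsWithin_of_mem_nhds (ball_mem_nhds v hε)] with w hw
  exact ⟨(hloc v hv ε hball w hw).symm, hloc v hv ε hball w hw⟩

end Measure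


end Summit.CriticalPhenomena.Ising3DConformalLimit.WardToMoebius
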